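/-
Copyright (c) 2026 the pub-hodgecm-mathlib formalisation cell (harness21).  Prover seat hodgecm-mathlib-K2E3-p11 (g7), Track B «K2-LIT» ∕ h413
(`stmt-HodgeConjecture-24833`), line `K2_E3_EllipticInputs`, road (11-3-split-nsc), leaf (nsc-S-A′) `sig_K2E3GL3PrincipalBlockStandardSpan` (owner K2E3-p25),
line «IH-x×x×x» (lead K2E3-p03 (g6); dealer K2E3-plan (g4) D71∕D78), brick IH-3, FILE 2∕2: JACQUET'S FIRST LEMMA AT LEVEL `Iw` AND «A NON-ZERO SUBREPRESENTATION
OF AN UNRAMIFIED PRINCIPAL SERIES OF `GL_n(F)` HAS A NON-ZERO `Iw`-FIXED VECTOR».  2026-09-04.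
-/
import Summits.HodgeConjecture.HodgeConjecture.Theorems.K2E3GLnIwahoriFactorisation    -- FILE 1∕2 (this seat): `exists_iwahoriDatum_iwahoriLevel` (datum with `K 0 = Iw`); brings ★ IH-1 `K2E3GL3IwahoriBruhat`, ★ `ParabolicGLBigCell`, ★ `JacquetLemma`
import Literature.NumberTheory.Automorphic.AdmissibleSubquotient                       -- ★ `IsAdmissible.toRepresentation` (a subrepresentation of an admissible representation is admissible)
import Literature.NumberTheory.Automorphic.SmoothCharacterOfCharacter                  -- ★ `isAdmissible_trivial_twist` (`ℂ_χ` admissible when `ker χ` is open)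
import Literature.NumberTheory.Automorphic.ParabolicGLProofs                           -- ★ `isAdmissible_parabolicIndGL_holds` (`i_c` preserves admissibility)
import Literature.NumberTheory.Automorphic.ParabolicInductionProofs                    -- ★ `rootDeltaChar_eq_one_of_mem_unipotentRadicalP` (`δ_P^{1∕2}|_U = 1`)
import HarnessLib

/-!
# K2_E3 road (h413), leaf (nsc-S-A′), line «IH-x×x×x», brick IH-3 (file 2∕2): Jacquet's first lemma `V^{Iw} ↠ (V_U)^{T(𝒪)}` for `GL_n(F)` at the Iwahori
# level, and: a non-zero subrepresentation of an unramified principal series has a non-zero `Iw`-fixed vector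

Cell `pub/hodgecm-mathlib` (D-0151), Track B, seat K2E3-p11 (g7); line lead K2E3-p03 (g6), architect K2E3-p25 (`MEMO-H4-residues.v1` §2, route (H) «Iwahori–Hecke 6×6»:
IH-1 ★ ∥ IH-3 → IH-2 → IH-4 ★ → IH-5 exporting `isIrreducible_parabolicIndGL_id_three_self`).  `--supports stmt-HodgeConjecture-24833 --as helper`; THEOREMS ONLY
(no definition ∕ instance ∕ notation ∕ named fact ∕ `sorry`); never imports `Cruxes/…/Lines`.  COUNT-NEUTRAL helper, GENERIC in `n`.

NOTATION (spelled out inline).  `F` a non-archimedean local field, `𝒪 = 𝒪[F]`; `B = standardParabolicGL F id`, `T = standardLeviGL F id`, `U = unipotentRadicalGL F id`,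
`Iw = iwahoriGL n F`, `T(𝒪) = {m : diag m ∈ Iw} = Iw.comap (blockDiagonalGL F id)`; `I(χ) = parabolicIndGL F id (𝟙.twist χ)` for a character `χ` of the diagonal torus
`Π a, GL {i // id i = a} F`, with inducing character `σ = (χ ∘ proj) · δ_B^{1∕2}`; `r_B(π) = jacquetGL F id π` (the `U`-coinvariants, Mathlib `Representation.Coinvariants`).

THE MATHEMATICS [Casselman1995, Thm. 3.3.3–3.3.4]; [Borel1976, §3–§4 (Lemma 4.7)]; [Casselman1980, §2 (Prop. 2.4–2.6), §3].
* §3 **JACQUET'S FIRST LEMMA AT LEVEL `Iw`** (`fixedPoints_jacquetGL_le_map_iwahori`): for an admissible `π` of `GL_n(F)`, every vector of `r_B(π)` fixed by `T(𝒪)` is the class of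
  an `Iw`-fixed vector of `π` — ★ `JacquetLemma.fixedPoints_jacquetModule_le_map` at level `0` of the datum of FILE 1 (`K 0 = Iw = (Iw ∩ U⁻) T(𝒪) (Iw ∩ U)`), transported
  along ★ `jacquetGLEquiv` exactly as the ★ template `fixedPoints_jacquetGL_le_map` of `IwahoriDatumGL` (levels `K_{|ϖ|^{j+1}}`; that module had no olean on the farm when
  this was typed, hence the template is re-run here rather than imported).
* §4 **DETECTION** (`exists_ne_zero_mem_fixedPoints_iwahori`, the form IH-5 consumes): `χ` UNRAMIFIED (★ IH-1's currency `hχ`) with open kernel, `N ≤ I(χ)` a non-zero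
  subrepresentation ⇒ `N^{Iw} ≠ 0`.  Take `f ∈ N` with `f(1) ≠ 0` (translate); average over `Iw ∩ T` (★ `JacquetLemma.exists_average_mem_fixedPoints`; the value at `1` is kept
  since `σ` is trivial on `B ∩ GL_n(𝒪)`, ★ IH-1 §4); the functional `ev₁ : f ↦ f(1)` kills `N(U)` (`σ|_U = 1`: `δ_B^{1∕2}|_U = 1` ★, `proj|_U = 1`), so the class of the average
  in `N_U` is non-zero and `T(𝒪)`-fixed; `N` is admissible (★ `isAdmissible_parabolicIndGL_holds`, ★ `IsAdmissible.toRepresentation`), so §3 lifts it to a NON-ZERO `Iw`-fixed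
  vector of `N`.  (Subrepresentation form; with complete reducibility it gives IH-5's `End_G I(χ) ↪ End I(χ)^{Iw}`.)
HONEST LABEL: HC_CM is proved only modulo the 7 printed citations (2 remaining named inputs: hLiu418 = stmt-HodgeConjecture-24832, h413 = stmt-HodgeConjecture-24833)
until rung 0 closes; count-neutral helper (structure theory; no printed citation is discharged).

## Mathlib ∕ tree search
Tree ★: FILE 1 `exists_iwahoriDatum_iwahoriLevel` · `jacquetGLEquiv`, `jacquetGL_mk`, `restrictUnipotentGL` (ParabolicGL) · `JacquetLemma.fixedPoints_jacquetModule_le_map`∕`exists_average_mem_fixedPoints`∕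
`apply_average_eq` · IH-1 `inducingChar_apply_eq_one_of_conj_mem_iwahori` · `exists_valuation_pos_lt_one` (ParabolicGLBigCell) · `rootDeltaChar_eq_one_of_mem_unipotentRadicalP` ·
`IsAdmissible.toRepresentation` · `isAdmissible_parabolicIndGL_holds` · `isAdmissible_trivial_twist` · `isSmooth_smoothInd`, `SmoothInd.toFun_subgroup_mul`, `Representation.twist_apply`.
Mathlib: `Representation.Coinvariants.lift`∕`lift_mk`∕`mk_surjective`, `Subrepresentation.toRepresentation`, `Subrepresentation.toSubmodule_injective`, `Submodule.ne_bot_iff`.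
Dedup: `rg "le_map_iwahori|fixedPoints_iwahori_of|toFun_one_apply_unipotent"` over `Literature Summits` — no `GL_n` hits at the Iwahori level (★ `fixedPoints_jacquetGL_le_map` is the
`K_{|ϖ|^{j+1}}`-level statement; the `U(3)` detection twin lives in the ★ `K2E3Keys…` files).

## References
* [Casselman1995] W. Casselman, *Introduction to the theory of admissible representations of p-adic reductive groups* (1995 notes), Prop. 1.4.4, Thm. 3.3.3–3.3.4.
* [Borel1976] A. Borel, *Admissible representations of a semi-simple group over a local field with vectors fixed under an Iwahori subgroup*, Invent. Math. 35 (1976), §3–§4.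
* [Casselman1980] W. Casselman, *The unramified principal series of p-adic groups I*, Compositio Math. 40 (1980), §2–§3.
* [BernsteinZelevinsky1977] I. N. Bernstein, A. V. Zelevinsky, Ann. Sci. ÉNS 10 (1977), §2.1–§2.3.  * [BruhatTits1972] F. Bruhat, J. Tits, Publ. Math. IHÉS 41 (1972), (4.4.3)–(4.4.4).
-/

set_option autoImplicit false
-- the mandated namespace repeats the single-problem summit's segment (`HodgeConjecture.HodgeConjecture`)
set_option linter.dupNamespace false

noncomputable section

open Matrix
open scoped MatrixGroups Pointwise
open Literature.NumberTheory.Automorphic ValuativeRel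
open Summit.HodgeConjecture.HodgeConjecture.Cruxes.H413.K2E3GL3IwahoriBruhat
open Summit.HodgeConjecture.HodgeConjecture.Cruxes.H413.K2E3GLnIwahoriFactorisation

namespace Summit.HodgeConjecture.HodgeConjecture.Cruxes.H413.K2E3GL3IwahoriFixedOfJacquet

universe u

section Jacquet

variable {F : Type u} [Field F] [ValuativeRel F] [TopologicalSpace F] [IsNonarchimedeanLocalField F] {n : ℕ}

/-! ## §3 Jacquet's first lemma at level `Iw`: `V^{Iw} ↠ (V_U)^{T(𝒪)}` -/

open Representation in
/-- **JACQUET'S FIRST LEMMA AT THE IWAHORI LEVEL** (Casselman's Thm. 3.3.3 for `K₀ = Iw = (Iw ∩ U⁻) T(𝒪) (Iw ∩ U)`): for an admissible representation `π` of `GL_n(F)`, every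
vector of the Jacquet module `r_B(π) = jacquetGL F id π` fixed by the Levi level `T(𝒪) = {m : diag m ∈ Iw}` is the class of an `Iw`-fixed vector of `π` — ★
`JacquetLemma.fixedPoints_jacquetModule_le_map` at level `0` of the datum of §2, transported along ★ `jacquetGLEquiv` (verbatim the ★ template `fixedPoints_jacquetGL_le_map`).
[cite: Casselman1995, Thm. 3.3.3] [cite: Borel1976, §3–§4] [cite: Casselman1980, §2] -/
theorem fixedPoints_jacquetGL_le_map_iwahori {V : Type*} [AddCommGroup V] [Module ℂ V] (π : Representation ℂ (GL (Fin n) F) V) (hπ : π.IsAdmissible) :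
    (jacquetGL F (id : Fin n → Fin n) π).fixedPoints ((iwahoriGL n F).comap (blockDiagonalGL F (id : Fin n → Fin n))) ≤
      (π.fixedPoints (iwahoriGL n F)).map (Coinvariants.mk (restrictUnipotentGL F (id : Fin n → Fin n) π)) := by
  haveI : IsTopologicalRing F := inferInstance
  obtain ⟨ϖ, hϖ0, hϖ1⟩ := exists_valuation_pos_lt_one (F := F)
  obtain ⟨𝓘, hK0, -, -, -⟩ := exists_iwahoriDatum_iwahoriLevel (n := n) hϖ0 hϖ1
  intro x hx
  obtain ⟨v, rfl⟩ := Coinvariants.mk_surjective _ x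
  -- the class of `v` in the abstract Jacquet module is `Iw ∩ T`-fixed
  have hy : Coinvariants.mk ((parabolicTripleGL F (id : Fin n → Fin n)).restrict π) v ∈
      (π.jacquetModule (parabolicTripleGL F (id : Fin n → Fin n))).fixedPoints
        ((𝓘.K 0).comap (parabolicTripleGL F (id : Fin n → Fin n)).M.subtype) := by
    rw [mem_fixedPoints]
    intro m hm
    obtain ⟨l, hl⟩ : ∃ l, leviEmbedding F (id : Fin n → Fin n) l = (m : GL (Fin n) F) := m.2
    have hml : m = (leviEmbedding F (id : Fin n → Fin n)).rangeRestrict l := Subtype.ext hl.symm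
    have hlK : l ∈ (iwahoriGL n F).comap (blockDiagonalGL F (id : Fin n → Fin n)) := by
      rw [Subgroup.mem_comap, ← leviEmbedding_apply, hl, ← hK0]
      exact Subgroup.mem_comap.1 hm
    have h1 := (mem_fixedPoints _ _ _).1 hx l hlK
    have h2 := (jacquetGLEquiv F (id : Fin n → Fin n) π).toIntertwiningMap.isIntertwining _ _ l
      (Coinvariants.mk (restrictUnipotentGL F (id : Fin n → Fin n) π) v)
    rw [h1] at h2
    rw [hml]
    have h3 : jacquetGLEquiv F (id : Fin n → Fin n) π (Coinvariants.mk (restrictUnipotentGL F (id : Fin n → Fin n) π) v) =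
        Coinvariants.mk ((parabolicTripleGL F (id : Fin n → Fin n)).restrict π) v := rfl
    rw [← h3]
    exact h2.symm
  obtain ⟨w, hw, hwv⟩ := JacquetLemma.fixedPoints_jacquetModule_le_map π (parabolicTripleGL F (id : Fin n → Fin n)) 𝓘 hπ 0 hy
  refine ⟨w, by rw [← hK0]; exact hw, ?_⟩
  -- `[w] = [v]` in `r_B(π)` since it holds after `jacquetGLEquiv`
  apply EquivLike.injective (jacquetGLEquiv F (id : Fin n → Fin n) π)
  change Coinvariants.mk ((parabolicTripleGL F (id : Fin n → Fin n)).restrict π) w =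
    Coinvariants.mk ((parabolicTripleGL F (id : Fin n → Fin n)).restrict π) v
  exact hwv

end Jacquet

/-! ## §4 Detection: a non-zero subrepresentation of an unramified principal series has a non-zero `Iw`-fixed vector -/

section Detection

variable {F : Type} [Field F] [ValuativeRel F] [TopologicalSpace F] [IsNonarchimedeanLocalField F] {n : ℕ}
  (χ : (Π a : Fin n, GL {i : Fin n // (id : Fin n → Fin n) i = a} F) →* ℂˣ)

/-- **The inducing character `(χ ∘ proj) · δ_B^{1∕2}` of `I(χ)` is trivial on the unipotent radical `U ≤ B`** (any `χ`): `δ_B^{1∕2}|_U = 1` ★ and `proj|_U = 1`.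
[cite: BernsteinZelevinsky1977, §2.1–§2.3] [cite: Casselman1995, Prop. 1.4.4] -/
theorem inducingChar_apply_eq_one_of_mem_unipotentRadicalP {u : ↥(standardParabolicGL F (id : Fin n → Fin n))} (hu : u ∈ unipotentRadicalP F (id : Fin n → Fin n)) :
    Representation.twist (((Representation.trivial ℂ (Π a : Fin n, GL {i : Fin n // (id : Fin n → Fin n) i = a} F) ℂ).twist χ).comp
      (leviProjection F (id : Fin n → Fin n))) (rootDeltaChar (standardParabolicGL F (id : Fin n → Fin n))) u = 1 := by
  apply LinearMap.ext
  intro z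
  rw [Representation.twist_apply, rootDeltaChar_eq_one_of_mem_unipotentRadicalP F (id : Fin n → Fin n) hu, MonoidHom.comp_apply,
    (MonoidHom.mem_ker).1 hu, map_one, Units.val_one, one_smul]

/-- **Right translation by `u ∈ U` does not change the value at `1`**: `(I(χ)(u) f)(1) = f(u) = σ(u) f(1) = f(1)`. [cite: BernsteinZelevinsky1977, §2.3] [cite: Casselman1995, Thm. 3.3.4] -/
theorem toFun_one_apply_unipotent (u : ↥(unipotentRadicalP F (id : Fin n → Fin n)))
    (f : Representation.SmoothInd (standardParabolicGL F (id : Fin n → Fin n))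
      (Representation.twist (((Representation.trivial ℂ (Π a : Fin n, GL {i : Fin n // (id : Fin n → Fin n) i = a} F) ℂ).twist χ).comp
        (leviProjection F (id : Fin n → Fin n))) (rootDeltaChar (standardParabolicGL F (id : Fin n → Fin n))))) :
    (Representation.parabolicIndGL F (id : Fin n → Fin n)
        ((Representation.trivial ℂ (Π a : Fin n, GL {i : Fin n // (id : Fin n → Fin n) i = a} F) ℂ).twist χ)
        (((u : ↥(standardParabolicGL F (id : Fin n → Fin n))) : GL (Fin n) F)) f).toFun 1 = f.toFun 1 := by
  show f.toFun (1 * (((u : ↥(standardParabolicGL F (id : Fin n → Fin n))) : GL (Fin n) F))) = f.toFun 1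
  rw [one_mul, ← mul_one (((u : ↥(standardParabolicGL F (id : Fin n → Fin n))) : GL (Fin n) F)), Representation.SmoothInd.toFun_subgroup_mul,
    inducingChar_apply_eq_one_of_mem_unipotentRadicalP χ u.2, Module.End.one_apply]

/-- **Right translation by `h ∈ Iw ∩ T` does not change the value at `1`** when `χ` is UNRAMIFIED (★ IH-1's currency `hχ`): `(I(χ)(h) f)(1) = f(h) = σ(h) f(1) = f(1)` since the
inducing character is trivial on `B ∩ GL_n(𝒪)` (★ IH-1 `inducingChar_apply_eq_one_of_conj_mem_iwahori`). [cite: Casselman1980, §3] [cite: Borel1976, §3–§4] -/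
theorem toFun_one_apply_iwahori_levi
    (hχ : ∀ p : ↥(standardParabolicGL F (id : Fin n → Fin n)), (p : GL (Fin n) F) ∈ glInt n F → χ (leviProjection F (id : Fin n → Fin n) p) = 1)
    {h : GL (Fin n) F} (hh : h ∈ iwahoriGL n F ⊓ standardLeviGL F (id : Fin n → Fin n))
    (f : Representation.SmoothInd (standardParabolicGL F (id : Fin n → Fin n))
      (Representation.twist (((Representation.trivial ℂ (Π a : Fin n, GL {i : Fin n // (id : Fin n → Fin n) i = a} F) ℂ).twist χ).comp
        (leviProjection F (id : Fin n → Fin n))) (rootDeltaChar (standardParabolicGL F (id : Fin n → Fin n))))) :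
    (Representation.parabolicIndGL F (id : Fin n → Fin n)
        ((Representation.trivial ℂ (Π a : Fin n, GL {i : Fin n // (id : Fin n → Fin n) i = a} F) ℂ).twist χ) h f).toFun 1 = f.toFun 1 := by
  have hB : h ∈ standardParabolicGL F (id : Fin n → Fin n) := standardLeviGL_le F _ hh.2
  show f.toFun (1 * h) = f.toFun 1
  rw [one_mul, show h = ((⟨h, hB⟩ : ↥(standardParabolicGL F (id : Fin n → Fin n))) : GL (Fin n) F) * 1 from (mul_one h).symm,
    Representation.SmoothInd.toFun_subgroup_mul,
    inducingChar_apply_eq_one_of_conj_mem_iwahori χ hχ (one_mem _) ⟨h, hB⟩ (by rw [inv_one, one_mul, Subgroup.coe_mk, mul_one]; exact hh.1),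
    Module.End.one_apply]

/-- **DETECTION OF SUBREPRESENTATIONS BY `Iw`-FIXED VECTORS** (the input of IH-5's `End_G I(χ) ↪ End I(χ)^{Iw}`): let `χ` be an UNRAMIFIED character of the diagonal torus
(`hχ`, ★ IH-1's currency) with open kernel (`hχo`, so that `I(χ)` is admissible ★), and `N ≤ I(χ) = parabolicIndGL F id (𝟙.twist χ)` a NON-ZERO subrepresentation.  Then `N`
contains a non-zero `Iw`-fixed vector.  Proof: pick `f ∈ N` with `f(1) ≠ 0` (translate a non-zero `f₀`); average it over `Iw ∩ T` inside `N` (★ `exists_average_mem_fixedPoints`;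
`f(1)` is unchanged, `toFun_one_apply_iwahori_levi`); the functional `ev₁ : f ↦ f(1)` on `N` kills `N(U)` (`toFun_one_apply_unipotent`), so it descends to the Jacquet module
`N_U` (Mathlib `Coinvariants.lift`) and the class of the average is a non-zero `T(𝒪)`-fixed vector of `N_U`; `N` is admissible (★ `isAdmissible_parabolicIndGL_holds`, ★
`IsAdmissible.toRepresentation`), so §3 `fixedPoints_jacquetGL_le_map_iwahori` lifts that class to an `Iw`-fixed vector of `N`, non-zero because its class is.
[cite: Borel1976, §3–§4] [cite: Casselman1980, §2–§3] [cite: Casselman1995, Thm. 3.3.3] -/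
theorem exists_ne_zero_mem_fixedPoints_iwahori
    (hχ : ∀ p : ↥(standardParabolicGL F (id : Fin n → Fin n)), (p : GL (Fin n) F) ∈ glInt n F → χ (leviProjection F (id : Fin n → Fin n) p) = 1)
    (hχo : IsOpen ((χ.ker : Subgroup (Π a : Fin n, GL {i : Fin n // (id : Fin n → Fin n) i = a} F)) :
      Set (Π a : Fin n, GL {i : Fin n // (id : Fin n → Fin n) i = a} F)))
    (N : Subrepresentation (Representation.parabolicIndGL F (id : Fin n → Fin n)
      ((Representation.trivial ℂ (Π a : Fin n, GL {i : Fin n // (id : Fin n → Fin n) i = a} F) ℂ).twist χ)))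
    (hN : N ≠ ⊥) :
    ∃ f ∈ N.toSubmodule, f ≠ 0 ∧ f ∈ (Representation.parabolicIndGL F (id : Fin n → Fin n)
      ((Representation.trivial ℂ (Π a : Fin n, GL {i : Fin n // (id : Fin n → Fin n) i = a} F) ℂ).twist χ)).fixedPoints (iwahoriGL n F) := by
  classical
  haveI : IsTopologicalRing F := inferInstance
  -- admissibility of `I(χ)` and of `N`
  have hadm : (Representation.parabolicIndGL F (id : Fin n → Fin n)
      ((Representation.trivial ℂ (Π a : Fin n, GL {i : Fin n // (id : Fin n → Fin n) i = a} F) ℂ).twist χ)).IsAdmissible :=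
    Representation.isAdmissible_parabolicIndGL_holds F (id : Fin n → Fin n) _ (isAdmissible_trivial_twist hχo)
  have hsm := hadm.1
  have hNadm : N.toRepresentation.IsAdmissible := hadm.toRepresentation N
  -- step 0: a vector `f₁ ∈ N` with `f₁(1) ≠ 0`
  have hN' : N.toSubmodule ≠ ⊥ := fun h => hN (Subrepresentation.toSubmodule_injective (by rw [h]; rfl))
  obtain ⟨f₀, hf₀N, hf₀0⟩ := (Submodule.ne_bot_iff _).1 hN'
  have hne : f₀.toFun ≠ (0 : Representation.SmoothInd (standardParabolicGL F (id : Fin n → Fin n))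
      (Representation.twist (((Representation.trivial ℂ (Π a : Fin n, GL {i : Fin n // (id : Fin n → Fin n) i = a} F) ℂ).twist χ).comp
        (leviProjection F (id : Fin n → Fin n))) (rootDeltaChar (standardParabolicGL F (id : Fin n → Fin n))))).toFun :=
    fun h => hf₀0 (Representation.SmoothInd.ext h)
  obtain ⟨g, hg⟩ := Function.ne_iff.1 hne
  have hg' : f₀.toFun g ≠ 0 := fun h0 => hg (by rw [h0]; rfl)
  set f₁ := Representation.parabolicIndGL F (id : Fin n → Fin n)
      ((Representation.trivial ℂ (Π a : Fin n, GL {i : Fin n // (id : Fin n → Fin n) i = a} F) ℂ).twist χ) g f₀ with hf₁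
  have hf₁N : f₁ ∈ N.toSubmodule := N.apply_mem_toSubmodule g hf₀N
  have hf₁1 : f₁.toFun 1 ≠ 0 := by
    rw [hf₁, show (Representation.parabolicIndGL F (id : Fin n → Fin n)
      ((Representation.trivial ℂ (Π a : Fin n, GL {i : Fin n // (id : Fin n → Fin n) i = a} F) ℂ).twist χ) g f₀).toFun 1 = f₀.toFun (1 * g) from rfl, one_mul]
    exact hg'
  -- step 1: average `f₁` over `Iw ∩ T` inside `N`
  obtain ⟨s, hsne, hsorb, hsfix⟩ := JacquetLemma.exists_average_mem_fixedPoints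
    (Representation.parabolicIndGL F (id : Fin n → Fin n)
      ((Representation.trivial ℂ (Π a : Fin n, GL {i : Fin n // (id : Fin n → Fin n) i = a} F) ℂ).twist χ))
    (iwahoriGL n F ⊓ standardLeviGL F (id : Fin n → Fin n)) (isCompact_iwahoriGL n F) (fun x hx => hx.1) (hsm f₁)
  have hf₂N : ((s.card : ℂ)⁻¹ • ∑ y ∈ s, y) ∈ N.toSubmodule := by
    refine Submodule.smul_mem _ _ (Submodule.sum_mem _ fun y hy => ?_)
    obtain ⟨h, hh, rfl⟩ := hsorb y hy
    exact N.apply_mem_toSubmodule h hf₁N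
  -- the functional `ev₁`
  let ev : Representation.SmoothInd (standardParabolicGL F (id : Fin n → Fin n))
      (Representation.twist (((Representation.trivial ℂ (Π a : Fin n, GL {i : Fin n // (id : Fin n → Fin n) i = a} F) ℂ).twist χ).comp
        (leviProjection F (id : Fin n → Fin n))) (rootDeltaChar (standardParabolicGL F (id : Fin n → Fin n)))) →ₗ[ℂ] ℂ :=
    { toFun := fun f => f.toFun 1
      map_add' := fun _ _ => rfl
      map_smul' := fun _ _ => rfl }
  have hev : ∀ f, ev f = f.toFun 1 := fun _ => rfl
  have hev₂ : ev ((s.card : ℂ)⁻¹ • ∑ y ∈ s, y) = f₁.toFun 1 := by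
    refine JacquetLemma.apply_average_eq ev hsne fun y hy => ?_
    obtain ⟨h, hh, rfl⟩ := hsorb y hy
    rw [hev]
    exact toFun_one_apply_iwahori_levi χ hχ hh f₁
  -- step 2: `ev₁` descends to the Jacquet module `N_U` of `N`
  have hinv : ∀ u : ↥(unipotentRadicalP F (id : Fin n → Fin n)),
      (ev ∘ₗ N.toSubmodule.subtype) ∘ₗ (Representation.restrictUnipotentGL F (id : Fin n → Fin n) N.toRepresentation) u = ev ∘ₗ N.toSubmodule.subtype := by
    intro u
    apply LinearMap.ext
    intro x
    simp only [LinearMap.coe_comp, Function.comp_apply, Submodule.coe_subtype]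
    rw [hev, hev]
    exact toFun_one_apply_unipotent χ u (x : _)
  -- step 3: the class of the average is `T(𝒪)`-fixed in `N_U`
  have hx : Representation.Coinvariants.mk (Representation.restrictUnipotentGL F (id : Fin n → Fin n) N.toRepresentation) ⟨_, hf₂N⟩ ∈
      (Representation.jacquetGL F (id : Fin n → Fin n) N.toRepresentation).fixedPoints
        ((iwahoriGL n F).comap (blockDiagonalGL F (id : Fin n → Fin n))) := by
    rw [Representation.mem_fixedPoints]
    intro m hm
    rw [Representation.jacquetGL_mk]
    congr 1
    apply Subtype.ext
    exact (Representation.mem_fixedPoints _ _ _).1 hsfix _ ⟨Subgroup.mem_comap.1 hm, ⟨m, rfl⟩⟩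
  -- step 4: lift it to an `Iw`-fixed vector of `N` (§3 for the admissible `N`)
  obtain ⟨w, hw, hwx⟩ := fixedPoints_jacquetGL_le_map_iwahori N.toRepresentation hNadm hx
  refine ⟨(w : _), w.2, fun hw0 => hf₁1 ?_, ?_⟩
  · -- non-vanishing: `ev₁` of the class is `f₁(1) ≠ 0`
    have hw' : w = 0 := Subtype.ext hw0
    rw [hw', map_zero] at hwx
    have key : Representation.Coinvariants.lift _ (ev ∘ₗ N.toSubmodule.subtype) hinv
        (Representation.Coinvariants.mk (Representation.restrictUnipotentGL F (id : Fin n → Fin n) N.toRepresentation) ⟨_, hf₂N⟩) = f₁.toFun 1 := by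
      rw [Representation.Coinvariants.lift_mk]
      exact hev₂
    rw [← key, ← hwx, map_zero]
  · rw [Representation.mem_fixedPoints]
    intro k hk
    exact congrArg Subtype.val ((Representation.mem_fixedPoints _ _ _).1 hw k hk)

end Detection

end Summit.HodgeConjecture.HodgeConjecture.Cruxes.H413.K2E3GL3IwahoriFixedOfJacquet

end
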